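import Mathlib

/-!
# `DivisionGap.PerCofactorDegreeReduction` (stmt-ValiantsHypothesis-15046), line `Sketch_ideator4`
(idea intrinsic-member-descent): two-factor rigidity (stub `stub_twoFactorRigidity`)

Bipartite picture on `n` rows and `n` columns: a cell `(r, c) ∈ A` is an edge between row `r`
and column `c`, and a permutation `σ` is the perfect matching with cells `(σ i, i)`.  The two
permutations `π₀, ρ₀` with `π₀ i ≠ ρ₀ i` span a simple `2`-factor
`H₀ = {(π₀ i, i)} ∪ {(ρ₀ i, i)}`; a cell `e ∈ A` with `π₀ e.2 ≠ e.1` and `ρ₀ e.2 ≠ e.1` is a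
*chord*.  The separation hypothesis says that for two distinct chords `e ≠ e'` the row of `e'`
is not `H₀`-adjacent to the column of `e`.  Conclusion: two cell-disjoint perfect matchings
`σ, τ` inside `A` only use `H₀`-cells.

Proof.  If `e := (σ i, i)` is a chord, pick the row `r ∈ {π₀ i, ρ₀ i}` with `r ≠ τ i`; also
`r ≠ σ i`.  The matchings `σ` and `τ` cover the row `r` at two columns `σ⁻¹ r ≠ τ⁻¹ r`, both
different from `i`, while the row `r` has only the two `H₀`-columns `π₀⁻¹ r, ρ₀⁻¹ r`, one of
which is `i`.  Hence one of `σ⁻¹ r, τ⁻¹ r`, call it `j`, is not an `H₀`-column of `r`, so the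
cell `(r, j) ∈ A` is a second chord, distinct from `e`, whose row `r` is `H₀`-adjacent to the
column `i` of `e` — contradicting the separation hypothesis. [folklore]
-/

-- `Summit.ValiantsHypothesis.ValiantsHypothesis.…` is the tree's mandated single-conjunct layout
-- (Sub = Summit), so the duplicated namespace component is intended.
set_option linter.dupNamespace false

namespace Summit.ValiantsHypothesis.ValiantsHypothesis.Theorems.DivisionGap.PerCofactorDegreeReduction.TwoFactorRigidity

/-- Core case of two-factor rigidity.  If the cell `(σ i, i)` of the matching `σ` is a chord
(`σ i ∉ {π₀ i, ρ₀ i}`) and the row `π₀ i` is not the `τ`-row of column `i`, then the row `π₀ i`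
is covered by `σ` and `τ` at two distinct columns different from `i`; at most one of them is the
second `H₀`-column `ρ₀⁻¹ (π₀ i)` of that row, so the other one carries a second chord in the row
`π₀ i`, which is `H₀`-adjacent to the column `i` of the first chord: the chord-separation
hypothesis `hchord` is violated. [folklore] -/
private theorem chord_column_absurd {n : ℕ} (π₀ ρ₀ σ τ : Equiv.Perm (Fin n))
    (A : Finset (Fin n × Fin n))
    (hchord : ∀ e ∈ A, ∀ e' ∈ A, π₀ e.2 ≠ e.1 → ρ₀ e.2 ≠ e.1 → π₀ e'.2 ≠ e'.1 →
      ρ₀ e'.2 ≠ e'.1 → e ≠ e' → π₀ e.2 ≠ e'.1 ∧ ρ₀ e.2 ≠ e'.1)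
    (hσ : ∀ i, (σ i, i) ∈ A) (hτ : ∀ i, (τ i, i) ∈ A) (hdis : ∀ i, σ i ≠ τ i)
    (i : Fin n) (hπ : σ i ≠ π₀ i) (hρ : σ i ≠ ρ₀ i) (hτi : τ i ≠ π₀ i) : False := by
  -- generic step: a column `j ≠ i` carrying an `A`-cell in the row `π₀ i` with `ρ₀ j ≠ π₀ i`
  -- yields the chord `(π₀ i, j)`, distinct from the chord `(σ i, i)` and adjacent to its column
  have key : ∀ j, j ≠ i → (π₀ i, j) ∈ A → ρ₀ j ≠ π₀ i → False := by
    intro j hji hjA hρj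
    have hπj : π₀ j ≠ π₀ i := fun h => hji (π₀.injective h)
    have hne : ((σ i, i) : Fin n × Fin n) ≠ (π₀ i, j) := fun h => hπ (congrArg Prod.fst h)
    exact (hchord (σ i, i) (hσ i) (π₀ i, j) hjA hπ.symm hρ.symm hπj hρj hne).1 rfl
  -- the columns `σ⁻¹ (π₀ i)` and `τ⁻¹ (π₀ i)` at which `σ` and `τ` cover the row `π₀ i`
  have hσj : σ (σ.symm (π₀ i)) = π₀ i := σ.apply_symm_apply _
  have hτj : τ (τ.symm (π₀ i)) = π₀ i := τ.apply_symm_apply _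
  -- they are distinct (the matchings are cell-disjoint) ...
  have h12 : σ.symm (π₀ i) ≠ τ.symm (π₀ i) := by
    intro h
    rw [h] at hσj
    exact hdis _ (hσj.trans hτj.symm)
  -- ... and both differ from `i`
  have h1i : σ.symm (π₀ i) ≠ i := by
    intro h
    rw [h] at hσj
    exact hπ hσj
  have h2i : τ.symm (π₀ i) ≠ i := by
    intro h
    rw [h] at hτj
    exact hτi hτj
  -- the `A`-cells of `σ` and `τ` in the row `π₀ i`
  have hA1 : (π₀ i, σ.symm (π₀ i)) ∈ A := by
    have h := hσ (σ.symm (π₀ i))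
    rwa [hσj] at h
  have hA2 : (π₀ i, τ.symm (π₀ i)) ∈ A := by
    have h := hτ (τ.symm (π₀ i))
    rwa [hτj] at h
  -- at most one of the two columns is the second `H₀`-column `ρ₀⁻¹ (π₀ i)` of the row `π₀ i`
  by_cases hρ1 : ρ₀ (σ.symm (π₀ i)) = π₀ i
  · exact key _ h2i hA2 fun h => h12 (ρ₀.injective (hρ1.trans h.symm))
  · exact key _ h1i hA1 hρ1

/-- **Two-factor rigidity.**  Let `π₀, ρ₀` be permutations of `Fin n` with `π₀ i ≠ ρ₀ i` for all
`i` (a simple `2`-factor `H₀` with cells `(π₀ i, i)`, `(ρ₀ i, i)`), contained in a cell set `A`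
whose chords (cells `e ∈ A` off `H₀`) are pairwise separated: for distinct chords `e ≠ e'` the
row `e'.1` is not `H₀`-adjacent to the column `e.2`.  Then any two cell-disjoint permutations
`σ, τ` supported in `A` use only `H₀`-cells: `σ i ∈ {π₀ i, ρ₀ i}` for every column `i`.
[folklore] -/
theorem stub_twoFactorRigidity :
    ∀ (n : ℕ) (π₀ ρ₀ : Equiv.Perm (Fin n)) (A : Finset (Fin n × Fin n)),
      (∀ i, π₀ i ≠ ρ₀ i) → (∀ i, (π₀ i, i) ∈ A ∧ (ρ₀ i, i) ∈ A) →
      (∀ e ∈ A, ∀ e' ∈ A, π₀ e.2 ≠ e.1 → ρ₀ e.2 ≠ e.1 → π₀ e'.2 ≠ e'.1 → ρ₀ e'.2 ≠ e'.1 →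
        e ≠ e' → π₀ e.2 ≠ e'.1 ∧ ρ₀ e.2 ≠ e'.1) →
      ∀ σ τ : Equiv.Perm (Fin n), (∀ i, (σ i, i) ∈ A) → (∀ i, (τ i, i) ∈ A) → (∀ i, σ i ≠ τ i) →
        ∀ i, σ i = π₀ i ∨ σ i = ρ₀ i := by
  intro n π₀ ρ₀ A hne _hH hchord σ τ hσ hτ hdis i
  by_contra hcon
  obtain ⟨hπ, hρ⟩ := not_or.mp hcon
  by_cases hτi : τ i = π₀ i
  · -- then `τ i ≠ ρ₀ i`: run the core case with the roles of `π₀` and `ρ₀` exchanged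
    have hτi' : τ i ≠ ρ₀ i := fun h => hne i (hτi.symm.trans h)
    exact chord_column_absurd ρ₀ π₀ σ τ A
      (fun e he e' he' h₁ h₂ h₃ h₄ h₅ => (hchord e he e' he' h₂ h₁ h₄ h₃ h₅).symm)
      hσ hτ hdis i hρ hπ hτi'
  · exact chord_column_absurd π₀ ρ₀ σ τ A hchord hσ hτ hdis i hπ hρ hτi

end Summit.ValiantsHypothesis.ValiantsHypothesis.Theorems.DivisionGap.PerCofactorDegreeReduction.TwoFactorRigidity
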